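import Summits.MatrixMultiplication.MatrixMultiplication.Theorems.SaturationLadderLevelTwoK2Word
import HarnessLib

/-!
# Level 2 of the saturation ladder at `ω(1,2,1)`: `ω(1,2,1) ≤ 101/31 = 3.25806…`
# (route `SaturationLadder`, node `TailDescentTwo`, lens 1, gen 22)

Cell `decomp-mm`, lens 1 («grading / quantitative ladder»), gen 22, file 3 of 5.  No named facts,
no sorry, no definitions (the design `lvl2Word` and its law are in the `…Word` file, the shared
lemmas in `SaturationLadderLevelTwoKit`).

THE RUNG.  The node `TailDescentTwo` of the route asks for `ω(1,2,1) = 3`; the quantitative ladder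
prices it by certified upper bounds.  Gen 20 (level 1, `CW_q` pooled): `ω(1,2,1) ≤ 278/85 =
3.27059` (`omegaRect_one_two_one_le_278_85`), the level-1 optimum to four digits.  This file climbs
to LEVEL 2 (Le Gall 2012 §6.1: the square `CW_q^{⊗2}`, fifteen components, the family
`{[112],[121],[211]}` extracted jointly) and proves

  **`ω(1,2,1) ≤ 101/31 = 3.258064…`**  (`omegaRect_one_two_one_le_101_31`),

`0.0125` below level 1 and `0.0014` above Le Gall's real-optimal level-2 value `3.256689`
(Table 2 of arXiv:1204.1111; the current record is `3.250385`, Williams–Xu–Xu–Zhou 2024, level ∞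
with refinements).  What made the difference at `k = 2` is NOT available at level 1 and was absent
from the gen-21 kernel (`cwSqFamWord`, proportions `1:1:2`, whose best `k = 2` bound is `3.2922 >
3.2706`): the `3 : 3 : 2` family block with Coppersmith–Winograd's splitting `σ = 19/20` of
`[112]`, `[121]` and Le Gall's `b̃ = 1` splitting of `[211]` (`hasFormatValue_laserBlock_cwSqFam332Word`).

THE PROOF.  The laser method on `lvl2Word` (`d = 2128`, `q = 6`; labels `cwLev2`, support
`cwSupport₂`, tightness `cwTight₂`, `r = 1`, `b = 4`) needs the penalty and the marginal entropies
of the law of the word.  The law of the word is of product form `f(I) g(J) g(L)` on the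
fourteen USED letters (`f = (2515227/1024, 61347/64, 286, 1)`, `g = (1, 1, 64/143, 2048/61347,
3072/2515227)`, integrality forced the identity `2·n₁₃₀·n₀₂₂ = 3·n₂₂₀·n₀₃₁`), and the letter `400`
is unused: since its ROW `I = 4` has marginal zero, every law with the same marginals vanishes there
too, so the penalty over `cwSupport₂` equals the penalty over the used support, which is `0`
(`maxEntropyPenalty_eq_of_row_zero`, `maxEntropyPenalty_eq_zero_of_mul`).  Marginals:
`x : (662, 922, 542, 2, 0)/2128`, `y = z : (164, 798, 1049, 114, 3)/2128`, `H_y ≤ H_x` by the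
integer certificate `cert_marginals`; formats `A² ≤ B` by `6^6149 ≤ 12^980 · 38^2360`; packing
`2^{H_y} W A^{ω(1,2,1)} ≤ R̃(CW_6^{⊗2}) ≤ 64` and the final integer certificate
`2^51969 · 41^5084 · 1049^32519 ≤ 3^47183 · 7^41230 · 19^50624` give `ω(1,2,1) ≤ 101/31`.

Bookkeeping (instrument `design332.py`/`intsearch332.py`, exact design): `H_x = 1.080531`,
`H_y = H_z = 1.080071` nats, `ln B/ln A = 2.000130`, bound `3.2574631`, slack to `101/31`: `6.0e-4`.

ON THE NODE.  `TailDescentTwo : (∃ k ≥ 3, ω(1,k,1) = k+1) → ω(1,2,1) = 3` is priced here through its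
conclusion only; at `a = 2` the hypothesis gives no head start in this currency (the descent
`ω(1,k,1) = k+1 ⇒ ω(1,k',1) = k'+1` is known only UPWARD, `k' ≥ k`, Coppersmith 1982 / tree
`omegaRect_one_mid_one_le_add`).  Gap of the rung to the node: `101/31 − 3 = 0.258`.

## References

* F. Le Gall, *Faster algorithms for rectangular matrix multiplication*, FOCS 2012,
  arXiv:1204.1111, §3, §6.1, Prop. 6.2, Table 2. [LeGall2012]
* D. Coppersmith, S. Winograd, *Matrix multiplication via arithmetic progressions*,
  J. Symbolic Comput. 9 (1990), §8. [CoppersmithWinograd1990]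
* D. Coppersmith, *Rectangular matrix multiplication revisited*, J. Complexity 13 (1997), §3.
  [Coppersmith1997]
* F. Le Gall, *Powers of tensors and fast matrix multiplication*, ISSAC 2014, arXiv:1401.7714,
  Thm. 4.1 and Appendix A.3. [LeGall2014]
* V. Vassilevska Williams, Y. Xu, Z. Xu, R. Zhou, *New bounds for matrix multiplication: from
  alpha to omega*, SODA 2024, Table 1. [VassilevskaWilliamsXuXuZhou2024]
-/

set_option linter.dupNamespace false
set_option autoImplicit false
set_option exponentiation.threshold 100000
set_option maxRecDepth 100000

noncomputable section

open Finset Real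
open scoped BigOperators

namespace Summit.MatrixMultiplication.MatrixMultiplication.Theorems.SaturationLadderLevelTwoK2

open Literature.Computability.AlgebraicComplexity
open SaturationLadderLevelTwoKit
open SaturationLadderLevelTwo (append_mem repWord_mem const_mem fin5_lits negMulLog_div'
  log_two_mul_shannonEntropy_fin5)

/-! ## Marginal entropies -/

/-- **`ln 2 · H_x = ln 2128 − (662 ln 662 + 922 ln 922 + 542 ln 542 + 2 ln 2)/2128`.** [folklore] -/
theorem entropy₁_lvl2Law : Real.log 2 * shannonEntropy (marginalDist₁ lvl2Law) =
    Real.log 2128 - (662 * Real.log 662 + 922 * Real.log 922 + 542 * Real.log 542 +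
      2 * Real.log 2) / 2128 := by
  obtain ⟨e0, e1, e2, e3, e4⟩ := marginalDist₁_lvl2Law
  rw [log_two_mul_shannonEntropy_fin5, e0, e1, e2, e3, e4,
    negMulLog_div' (by norm_num) (by norm_num), negMulLog_div' (by norm_num) (by norm_num),
    negMulLog_div' (by norm_num) (by norm_num), negMulLog_div' (by norm_num) (by norm_num),
    Real.negMulLog_zero]
  ring

/-- **`ln 2 · H_y = ln 2128 − (164 ln 164 + 798 ln 798 + 1049 ln 1049 + 114 ln 114 + 3 ln 3)/2128`.**
[folklore] -/
theorem entropy₂_lvl2Law : Real.log 2 * shannonEntropy (marginalDist₂ lvl2Law) =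
    Real.log 2128 - (164 * Real.log 164 + 798 * Real.log 798 + 1049 * Real.log 1049 +
      114 * Real.log 114 + 3 * Real.log 3) / 2128 := by
  obtain ⟨e0, e1, e2, e3, e4⟩ := marginalDist₂_lvl2Law
  rw [log_two_mul_shannonEntropy_fin5, e0, e1, e2, e3, e4,
    negMulLog_div' (by norm_num) (by norm_num), negMulLog_div' (by norm_num) (by norm_num),
    negMulLog_div' (by norm_num) (by norm_num), negMulLog_div' (by norm_num) (by norm_num),
    negMulLog_div' (by norm_num) (by norm_num)]
  ring

/-- `ln 2 · H_z = ln 2 · H_y`. [folklore] -/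
theorem entropy₃_lvl2Law : Real.log 2 * shannonEntropy (marginalDist₃ lvl2Law) =
    Real.log 2128 - (164 * Real.log 164 + 798 * Real.log 798 + 1049 * Real.log 1049 +
      114 * Real.log 114 + 3 * Real.log 3) / 2128 := by
  obtain ⟨e0, e1, e2, e3, e4⟩ := marginalDist₃_lvl2Law
  rw [log_two_mul_shannonEntropy_fin5, e0, e1, e2, e3, e4,
    negMulLog_div' (by norm_num) (by norm_num), negMulLog_div' (by norm_num) (by norm_num),
    negMulLog_div' (by norm_num) (by norm_num), negMulLog_div' (by norm_num) (by norm_num),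
    negMulLog_div' (by norm_num) (by norm_num)]
  ring

/-- Integer certificate: `∏ u_x^{u_x} ≤ ∏ u_y^{u_y}` (`H_y ≤ H_x`). [folklore] -/
theorem cert_marginals :
    (662 : ℕ) ^ 662 * 922 ^ 922 * 542 ^ 542 * 2 ^ 2 ≤
      164 ^ 164 * 798 ^ 798 * 1049 ^ 1049 * 114 ^ 114 * 3 ^ 3 := by
  decide

/-! ## The certificates and the conclusion -/

/-- Integer certificate: `6^6149 ≤ 12^980 · 38^2360` (`A² ≤ B` for the per-position formats).
[folklore] -/
theorem cert_format : (6 : ℕ) ^ 6149 ≤ 12 ^ 980 * 38 ^ 2360 := by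
  decide

/-- Integer certificate of the final inequality `31 (ln 64 − H_y ln 2 − ln W) ≤ 101 ln A`:
`2^51969 · 41^5084 · 1049^32519 ≤ 3^47183 · 7^41230 · 19^50624`. [folklore] -/
theorem cert_final :
    (2 : ℕ) ^ 51969 * 41 ^ 5084 * 1049 ^ 32519 ≤ 3 ^ 47183 * 7 ^ 41230 * 19 ^ 50624 := by
  decide

/-- **Level 2 of the saturation ladder at the node `TailDescentTwo`: `ω(1,2,1) ≤ 101/31`**
(Le Gall 2012 §6 at `q = 6` in the tree's format currency, with the `3 : 3 : 2` family block at
`σ = 19/20` and the explicit design `lvl2Word`).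
[cite: LeGall2012, §6.1, Prop. 6.2 and Table 2] [cite: CoppersmithWinograd1990, §8]
[cite: Coppersmith1997, §3] -/
theorem omegaRect_one_two_one_le_101_31 : omegaRect ℂ 1 2 1 ≤ 101 / 31 := by
  -- the minimum marginal entropy is `H_y` (folded in: `H_y ≤ H_x`, `H_z = H_y`)
  have entropy₂_le_entropy₁ :
      shannonEntropy (marginalDist₂ lvl2Law) ≤ shannonEntropy (marginalDist₁ lvl2Law) := by
    have hlog : 0 < Real.log 2 := Real.log_pos one_lt_two
    have h : ((662 : ℕ) ^ 662 * 922 ^ 922 * 542 ^ 542 * 2 ^ 2 : ℝ) ≤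
        (164 : ℕ) ^ 164 * 798 ^ 798 * 1049 ^ 1049 * 114 ^ 114 * 3 ^ 3 := by
      exact_mod_cast cert_marginals
    push_cast at h
    have h' := Real.log_le_log (by positivity) h
    rw [Real.log_mul (by positivity) (by positivity), Real.log_mul (by positivity) (by positivity),
      Real.log_mul (by positivity) (by positivity), Real.log_mul (by positivity) (by positivity),
      Real.log_mul (by positivity) (by positivity), Real.log_mul (by positivity) (by positivity),
      Real.log_mul (by positivity) (by positivity)] at h'
    simp only [Real.log_pow, Nat.cast_ofNat] at h'
    have e1 := entropy₁_lvl2Law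
    have e2 := entropy₂_lvl2Law
    have key : Real.log 2 * shannonEntropy (marginalDist₂ lvl2Law) ≤
        Real.log 2 * shannonEntropy (marginalDist₁ lvl2Law) := by
      rw [e1, e2]
      linarith [h']
    exact le_of_mul_le_mul_left key hlog
  have entropy₃_eq_entropy₂ :
      shannonEntropy (marginalDist₃ lvl2Law) = shannonEntropy (marginalDist₂ lvl2Law) := by
    have hlog : Real.log 2 ≠ 0 := (Real.log_pos one_lt_two).ne'
    have e := entropy₃_lvl2Law
    rw [← entropy₂_lvl2Law] at e
    exact mul_left_cancel₀ hlog e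
  have min_entropy_lvl2Law :
      min (shannonEntropy (marginalDist₁ lvl2Law)) (min (shannonEntropy (marginalDist₂ lvl2Law))
        (shannonEntropy (marginalDist₃ lvl2Law))) = shannonEntropy (marginalDist₂ lvl2Law) := by
    rw [entropy₃_eq_entropy₂, min_self]
    exact min_eq_right entropy₂_le_entropy₁
  -- per-position value and formats: the `2128`-th roots of the totals
  set W : ℝ := Vtot ^ (((2128 : ℕ) : ℝ)⁻¹) with hWdef
  set A : ℝ := Xtot ^ (((2128 : ℕ) : ℝ)⁻¹) with hAdef
  set B : ℝ := Ytot ^ (((2128 : ℕ) : ℝ)⁻¹) with hBdef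
  have hW0 : 0 < W := Real.rpow_pos_of_pos Vtot_pos _
  have hA0 : 0 < A := Real.rpow_pos_of_pos Xtot_pos _
  have hB0 : 0 < B := Real.rpow_pos_of_pos Ytot_pos _
  have hWd : W ^ 2128 = Vtot := Real.rpow_inv_natCast_pow Vtot_pos.le (by norm_num)
  have hAd : A ^ 2128 = Xtot := Real.rpow_inv_natCast_pow Xtot_pos.le (by norm_num)
  have hBd : B ^ 2128 = Ytot := Real.rpow_inv_natCast_pow Ytot_pos.le (by norm_num)
  have hblk : HasFormatValue (blockOf lvl2Word) (W ^ 2128) (A ^ 2128) (B ^ 2128) (A ^ 2128) := by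
    rw [hWd, hAd, hBd]; exact hasFormatValue_lvl2Word
  -- the laser method on the valued word
  have hT := laserMethod_hasFormatValue_of_wordValue (bigCwSq ℂ 6) cwLev2 cwLev2 cwLev2
    cwSupport₂ (bigCwSq_cwSupport₂ ℂ 6) cwTight₂ cwTight₂ cwTight₂γ cwTight₂_injective
    cwTight₂_injective cwTight₂γ_injective cwTight₂_bound cwTight₂_bound cwTight₂_sum
    (by norm_num : 0 < 2128) lvl2Word lvl2Word_mem lvl2Law lvl2Law_eq hW0 hA0.le hB0.le hA0.le
    hblk
  rw [maxEntropyPenalty_lvl2Law, sub_zero, min_entropy_lvl2Law] at hT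
  -- logarithms of the roots
  have hlogW : Real.log W = (2128 : ℝ)⁻¹ * (143 * (6 * Real.log 2)) := by
    rw [hWdef, Real.log_rpow Vtot_pos, Vtot, one_mul, Real.log_pow,
      Real.log_rpow (by norm_num : (0 : ℝ) < 2)]
    push_cast; ring
  have hlogA : Real.log A = (2128 : ℝ)⁻¹ *
      (33 * Real.log 12 + 128 * Real.log 38 + 143 * (5 * Real.log 6)) := by
    rw [hAdef, Real.log_rpow Xtot_pos, Xtot, Real.log_mul (by positivity) (by positivity),
      Real.log_mul (by positivity) (by positivity), Real.log_pow, Real.log_pow, Real.log_pow,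
      Real.log_rpow (by norm_num : (0 : ℝ) < 6)]
    push_cast; ring
  have hlogB : Real.log B = (2128 : ℝ)⁻¹ *
      (164 * Real.log 12 + 492 * Real.log 38 + 143 * (57 / 10 * Real.log 6)) := by
    rw [hBdef, Real.log_rpow Ytot_pos, Ytot, Real.log_mul (by positivity) (by positivity),
      Real.log_mul (by positivity) (by positivity), Real.log_pow, Real.log_pow, Real.log_pow,
      Real.log_rpow (by norm_num : (0 : ℝ) < 6)]
    push_cast; ring
  have l12 : Real.log 12 = 2 * Real.log 2 + Real.log 3 := by
    rw [show (12 : ℝ) = 2 ^ 2 * 3 by norm_num, Real.log_mul (by norm_num) (by norm_num),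
      Real.log_pow]; push_cast; ring
  have l38 : Real.log 38 = Real.log 2 + Real.log 19 := by
    rw [show (38 : ℝ) = 2 * 19 by norm_num, Real.log_mul (by norm_num) (by norm_num)]
  have l6 : Real.log 6 = Real.log 2 + Real.log 3 := by
    rw [show (6 : ℝ) = 2 * 3 by norm_num, Real.log_mul (by norm_num) (by norm_num)]
  have l64 : Real.log 64 = 6 * Real.log 2 := by
    rw [show (64 : ℝ) = 2 ^ 6 by norm_num, Real.log_pow]; push_cast; ring
  have l2128 : Real.log 2128 = 4 * Real.log 2 + Real.log 7 + Real.log 19 := by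
    rw [show (2128 : ℝ) = 2 ^ 4 * 7 * 19 by norm_num, Real.log_mul (by norm_num) (by norm_num),
      Real.log_mul (by norm_num) (by norm_num), Real.log_pow]; push_cast; ring
  have l164 : Real.log 164 = 2 * Real.log 2 + Real.log 41 := by
    rw [show (164 : ℝ) = 2 ^ 2 * 41 by norm_num, Real.log_mul (by norm_num) (by norm_num),
      Real.log_pow]; push_cast; ring
  have l798 : Real.log 798 = Real.log 2 + Real.log 3 + Real.log 7 + Real.log 19 := by
    rw [show (798 : ℝ) = 2 * 3 * 7 * 19 by norm_num, Real.log_mul (by norm_num) (by norm_num),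
      Real.log_mul (by norm_num) (by norm_num), Real.log_mul (by norm_num) (by norm_num)]
  have l114 : Real.log 114 = Real.log 2 + Real.log 3 + Real.log 19 := by
    rw [show (114 : ℝ) = 2 * 3 * 19 by norm_num, Real.log_mul (by norm_num) (by norm_num),
      Real.log_mul (by norm_num) (by norm_num)]
  -- (1) `A > 1`
  have hX1 : 1 < Xtot := by
    unfold Xtot
    have h1 : (1 : ℝ) < 12 ^ 33 * 38 ^ 128 := by norm_num
    have h2 : (1 : ℝ) ≤ ((6 : ℝ) ^ (5 : ℝ)) ^ 143 :=
      one_le_pow₀ (Real.one_le_rpow (by norm_num) (by norm_num))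
    exact one_lt_mul_of_lt_of_le h1 h2
  have hA1 : 1 < A := Real.one_lt_rpow hX1 (by positivity)
  have hlA : 0 < Real.log A := Real.log_pos hA1
  -- (2) the format inequality `A² ≤ B`
  have hAB : A ^ (2 : ℝ) ≤ B := by
    rw [← Real.log_le_log_iff (Real.rpow_pos_of_pos hA0 _) hB0, Real.log_rpow hA0, hlogA, hlogB]
    have hc : ((6 : ℕ) ^ 6149 : ℝ) ≤ (12 : ℕ) ^ 980 * (38 : ℕ) ^ 2360 := by
      exact_mod_cast cert_format
    push_cast at hc
    have hc' := Real.log_le_log (by positivity) hc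
    rw [Real.log_mul (by positivity) (by positivity)] at hc'
    simp only [Real.log_pow, Nat.cast_ofNat] at hc'
    linarith
  -- (3) the packing bound `2^{H_y} W A^{ω(1,2,1)} ≤ R̃(CW_6^{⊗2}) ≤ 64`, in logarithms
  have hmain := mul_rpow_omegaRect_le_asymptoticRank_of_hasFormatValue hT hA1 (by norm_num) hAB
  have h64 := hmain.trans asymptoticRank_bigCwSq_six_le
  have hpos : 0 < (2 : ℝ) ^ shannonEntropy (marginalDist₂ lvl2Law) * W * A ^ omegaRect ℂ 1 2 1 := by
    positivity
  have hlog := Real.log_le_log hpos h64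
  rw [Real.log_mul (by positivity) (by positivity), Real.log_mul (by positivity) (by positivity),
    Real.log_rpow (by norm_num : (0 : ℝ) < 2), Real.log_rpow hA0] at hlog
  -- (4) the final certificate: `ln 64 − H_y ln 2 − ln W ≤ (101/31) ln A`
  have e2 := entropy₂_lvl2Law
  rw [l2128, l164, l798, l114] at e2
  have hc : ((2 : ℕ) ^ 51969 * (41 : ℕ) ^ 5084 * (1049 : ℕ) ^ 32519 : ℝ) ≤
      (3 : ℕ) ^ 47183 * (7 : ℕ) ^ 41230 * (19 : ℕ) ^ 50624 := by
    exact_mod_cast cert_final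
  push_cast at hc
  have hc' := Real.log_le_log (by positivity) hc
  rw [Real.log_mul (by positivity) (by positivity), Real.log_mul (by positivity) (by positivity),
    Real.log_mul (by positivity) (by positivity), Real.log_mul (by positivity) (by positivity)] at hc'
  simp only [Real.log_pow, Nat.cast_ofNat] at hc'
  have hfin : Real.log 64 - shannonEntropy (marginalDist₂ lvl2Law) * Real.log 2 - Real.log W ≤
      101 / 31 * Real.log A := by
    rw [hlogW, hlogA, l64, l12, l38, l6]
    linarith
  have key : omegaRect ℂ 1 2 1 * Real.log A ≤ 101 / 31 * Real.log A := by linarith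
  exact le_of_mul_le_mul_right key hlA

/-- **`ω(1,2,1) < 3.25807`.** [cite: LeGall2012, Table 2] -/
theorem omegaRect_one_two_one_lt_3_25807 : omegaRect ℂ 1 2 1 < 3.25807 :=
  lt_of_le_of_lt omegaRect_one_two_one_le_101_31 (by norm_num)

/-- **Level 2 beats level 1 at `ω(1,2,1)`**: `101/31 < 278/85` (the gen-20 level-1 price
`omegaRect_one_two_one_le_278_85`), indeed below the level-1 optimum `3.2705`. [cite: LeGall2012, Table 2] -/
theorem omegaRect_one_two_one_lt_level_one : omegaRect ℂ 1 2 1 < 278 / 85 :=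
  lt_of_le_of_lt omegaRect_one_two_one_le_101_31 (by norm_num)

/-- The remaining gap of the rung to the node `TailDescentTwo` (`ω(1,2,1) = 3`) is `< 0.2581`.
[cite: LeGall2012, Table 2] -/
theorem omegaRect_one_two_one_sub_three_lt : omegaRect ℂ 1 2 1 - 3 < 0.2581 := by
  have := omegaRect_one_two_one_le_101_31; norm_num at this ⊢; linarith

end Summit.MatrixMultiplication.MatrixMultiplication.Theorems.SaturationLadderLevelTwoK2

end
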